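import Mathlib

/-!
# STUB-IDEAS k1 (gen 18) — typed sketch: «THE DIRECTION DIGIT IS A GAUGE ARTEFACT»

Stub-ideation seat `sidea-stub_heegnerIndexLowerAtTwo-1-g18` (planner, technique «weaken / strengthen»),
crux `stmt-BirchSwinnertonDyer-27851` = `PrintCf2.SplitBadTwoLowerHalfOfFacts`, STUB
`stub_heegnerIndexLowerAtTwo` (child skeleton `heegner_index_two_lower`, sha16 `f2bd84c029a8a938`).

Nothing here proves the stub, the crux, S2′ or BSD.  What is kernel-checked is LINEAR ALGEBRA on the
model of the CM plane `V = W(K₀)_ℚ ⊗ F̄` (W a class member, `K₀ = ℚ(√-7)`, `2 = 𝔭 𝔭̄` split):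

* `B`  = the `F̄`-bilinear extension of the Néron–Tate pairing (symmetric; the CM endomorphism
  `J = [√-7]` is skew for it — Rosati = complex conjugation — and `B (J x) (J y) = 7 · B x y`
  because `ĥ ∘ [α] = N(α) · ĥ`);
* `ℓ₁` = `log_ω` read at a place above `𝔭`, `ℓ₂` = `log_ω` read at the conjugate place above `𝔭̄`
  (`ℓ₁ ∘ J = s · ℓ₁`, `ℓ₂ ∘ J = -s · ℓ₂`, `s = ι_𝔭(√-7)`, `s² = -7`: the CM acts on `Lie Ŵ` through
  `ι_𝔭` at `𝔭` and through `ῑ_𝔭` at `𝔭̄`);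
* `P` = the rational generator (`W(ℚ) ⊗ ℚ = ℚ · P`), so `{P, J P}` spans `V` and `ℓ₁ P = ℓ₂ P`.

MAIN IDENTITY (§A, `height_eq_polarised_logProduct`): on `V`
  `2 · ℓ₁(P) ℓ₂(P) · B(x, y) = B(P, P) · (ℓ₁(x) ℓ₂(y) + ℓ₁(y) ℓ₂(x))`,
i.e. THE NÉRON–TATE FORM IS THE POLARISED PRODUCT OF THE TWO 2-ADIC LOGARITHMS.  Consequences:
the type-`ι` line `ker (J - s)` is `ker ℓ₂` and isotropic, the type-`ῑ` line is `ker ℓ₁`, and for ANY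
`z⁺` on the first and `z⁻` on the second (`transfer_factor_two`)
  `2 · ℓ₁(P) ℓ₂(P) · B(z⁺, z⁻) = B(P, P) · ℓ₁(z⁺) ℓ₂(z⁻)` :
the Heegner-vector-to-rational-point transfer factor of LZZ's PRODUCT currency
(`log_{A⁺} P⁺ · log_{A⁻} P⁻` against YZZ's `⟨P⁺, P⁻⟩`, arXiv:1511.08172 Thm 3.10) is the pure number
`2`, direction-free and scale-free — the residual ρ3 («direction digit») of STUB-PLAN v3.9 is absent
in that currency.  §B books the SQUARE currency (one logarithm squared against a Hermitian height):
there the digit `β` is the projector-gauge digit, cancels against the gauge part of the ERL prefactor,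
and the canonical remainder is a degree digit (R136).  §C is the tensor-free LZZ ÷ YZZ quotient
(P-R133 / B22♯ written out).  §D: an `𝔽₁₁`-avatar (`-7 ≡ 2²`) checked by `decide`.
-/

set_option linter.dupNamespace false
set_option autoImplicit false

namespace Summit.BirchSwinnertonDyer.BirchSwinnertonDyer.Cruxes.SplitBadTwoLowerHalfOfFacts.HeegnerIndexTwo.K1G18

/-! ## §A  The CM plane: Néron–Tate = polarised product of the two logarithms -/

section CMPlane

variable {F V : Type*} [Field F] [AddCommGroup V] [Module F V]

/-- A symmetric form for which `J` is skew pairs `P` with `J P` to zero (needs `2 ≠ 0`). -/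
theorem pairing_self_J_eq_zero (B : V →ₗ[F] V →ₗ[F] F) (J : V →ₗ[F] V)
    (hsymm : ∀ u v, B u v = B v u) (hskew : ∀ u v, B (J u) v = -B u (J v))
    (h2 : (2 : F) ≠ 0) (P : V) : B P (J P) = 0 := by
  have h : B P (J P) = -B P (J P) := by
    calc B P (J P) = B (J P) P := hsymm _ _
      _ = -B P (J P) := hskew _ _
  have h' : (2 : F) * B P (J P) = 0 := by linear_combination h
  rcases mul_eq_zero.mp h' with h2' | h0
  · exact absurd h2' h2
  · exact h0

/-- **Main identity.**  On the plane spanned by `P` and `J P`: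
`2 ℓ₁(P) ℓ₂(P) · B(x,y) = B(P,P) · (ℓ₁ x ℓ₂ y + ℓ₁ y ℓ₂ x)`.
Hypotheses: `B` symmetric, `J` skew for `B` with `B (J u) (J v) = D · B u v`, `ℓ₁ ∘ J = s ℓ₁`,
`ℓ₂ ∘ J = -s ℓ₂`, `s² = -D`, `char ≠ 2`.  (Dictionary: `D = 7`, `B` = Néron–Tate, `ℓ₁, ℓ₂` = `log_ω`
at `𝔭`, `𝔭̄`, `P ∈ W(ℚ)`.) -/
theorem height_eq_polarised_logProduct (B : V →ₗ[F] V →ₗ[F] F) (J : V →ₗ[F] V)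
    (ℓ₁ ℓ₂ : V →ₗ[F] F) (s D : F) (hs : s * s = -D)
    (hsymm : ∀ u v, B u v = B v u) (hskew : ∀ u v, B (J u) v = -B u (J v))
    (hBJ : ∀ u v, B (J u) (J v) = D * B u v)
    (hℓ₁ : ∀ u, ℓ₁ (J u) = s * ℓ₁ u) (hℓ₂ : ∀ u, ℓ₂ (J u) = -(s * ℓ₂ u))
    (h2 : (2 : F) ≠ 0) (P : V) (a b c d : F) :
    2 * (ℓ₁ P * ℓ₂ P) * B (a • P + b • J P) (c • P + d • J P)
      = B P P * (ℓ₁ (a • P + b • J P) * ℓ₂ (c • P + d • J P)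
                  + ℓ₁ (c • P + d • J P) * ℓ₂ (a • P + b • J P)) := by
  have h4 : B P (J P) = 0 := pairing_self_J_eq_zero B J hsymm hskew h2 P
  have h5 : B (J P) P = 0 := by rw [hsymm]; exact h4
  have h3 : B (J P) (J P) = D * B P P := hBJ P P
  simp only [map_add, map_smul, LinearMap.add_apply, LinearMap.smul_apply, smul_eq_mul,
    h3, h4, h5, hℓ₁, hℓ₂]
  linear_combination (2 * B P P * ℓ₁ P * ℓ₂ P * b * d) * hs

/-- The type-`ι` eigenline (`J z = s z`) lies in `ker ℓ₂`: the `𝔭̄`-logarithm kills it. -/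
theorem log₂_eq_zero_of_typeIota (J : V →ₗ[F] V) (ℓ₂ : V →ₗ[F] F) (s : F)
    (hℓ₂ : ∀ u, ℓ₂ (J u) = -(s * ℓ₂ u)) (h2 : (2 : F) ≠ 0) (hs0 : s ≠ 0)
    (z : V) (hz : J z = s • z) : ℓ₂ z = 0 := by
  have h : s * ℓ₂ z = -(s * ℓ₂ z) := by
    have := hℓ₂ z
    rw [hz, map_smul, smul_eq_mul] at this
    exact this
  have h' : (2 * s) * ℓ₂ z = 0 := by linear_combination h
  rcases mul_eq_zero.mp h' with h1 | h1
  · exact absurd h1 (mul_ne_zero h2 hs0)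
  · exact h1

/-- The type-`ῑ` eigenline (`J z = -s z`) lies in `ker ℓ₁`: the `𝔭`-logarithm kills it. -/
theorem log₁_eq_zero_of_typeIotaBar (J : V →ₗ[F] V) (ℓ₁ : V →ₗ[F] F) (s : F)
    (hℓ₁ : ∀ u, ℓ₁ (J u) = s * ℓ₁ u) (h2 : (2 : F) ≠ 0) (hs0 : s ≠ 0)
    (z : V) (hz : J z = -(s • z)) : ℓ₁ z = 0 := by
  have h : -(s * ℓ₁ z) = s * ℓ₁ z := by
    have := hℓ₁ z
    rw [hz, map_neg, map_smul, smul_eq_mul] at this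
    exact this
  have h' : (2 * s) * ℓ₁ z = 0 := by linear_combination -h
  rcases mul_eq_zero.mp h' with h1 | h1
  · exact absurd h1 (mul_ne_zero h2 hs0)
  · exact h1

/-- Each eigenline is ISOTROPIC for the Néron–Tate form (so GZ never pairs `P_χ` with itself). -/
theorem isotropic_of_typeIota (B : V →ₗ[F] V →ₗ[F] F) (J : V →ₗ[F] V) (s D : F)
    (hs : s * s = -D) (hBJ : ∀ u v, B (J u) (J v) = D * B u v) (hD : D ≠ 0) (h2 : (2 : F) ≠ 0)
    (z : V) (hz : J z = s • z) : B z z = 0 := by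
  have h := hBJ z z
  rw [hz] at h
  simp only [map_smul, LinearMap.smul_apply, smul_eq_mul] at h
  -- h : s * (s * B z z) = D * B z z
  have h' : (2 * D) * B z z = 0 := by linear_combination -h + B z z * hs
  rcases mul_eq_zero.mp h' with h1 | h1
  · exact absurd h1 (mul_ne_zero h2 hD)
  · exact h1

/-- The explicit eigenvectors: `s • P + J P` is type `ι`, `-(s • P) + J P` is type `ῑ`
(needs `J (J P) = -D • P`). -/
theorem eigen_plus (J : V →ₗ[F] V) (s D : F) (hs : s * s = -D) (P : V)
    (hJJ : J (J P) = -(D • P)) : J (s • P + J P) = s • (s • P + J P) := by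
  rw [map_add, map_smul, hJJ, smul_add, smul_smul, hs, neg_smul]
  abel

theorem eigen_minus (J : V →ₗ[F] V) (s D : F) (hs : s * s = -D) (P : V)
    (hJJ : J (J P) = -(D • P)) : J (-(s • P) + J P) = -(s • (-(s • P) + J P)) := by
  rw [map_add, map_neg, map_smul, hJJ, smul_add, smul_neg, smul_smul, hs, neg_smul]
  abel

/-- **Transfer factor = 2 (direction-free, scale-free).**  For `x` in the plane with `ℓ₂ x = 0`
(type `ι`: the W-shadow of `P⁺_χ(f₊)`) and `y` with `ℓ₁ y = 0` (type `ῑ`: the W-shadow of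
`P⁻_χ(f₋)`, built on the conjugate CM point `P⁻ = 𝐜 P⁺`):
`2 ℓ₁(P) ℓ₂(P) · B(x, y) = B(P, P) · ℓ₁(x) ℓ₂(y)` — whatever the scalars in front of `x`, `y`. -/
theorem transfer_factor_two (B : V →ₗ[F] V →ₗ[F] F) (J : V →ₗ[F] V)
    (ℓ₁ ℓ₂ : V →ₗ[F] F) (s D : F) (hs : s * s = -D)
    (hsymm : ∀ u v, B u v = B v u) (hskew : ∀ u v, B (J u) v = -B u (J v))
    (hBJ : ∀ u v, B (J u) (J v) = D * B u v)
    (hℓ₁ : ∀ u, ℓ₁ (J u) = s * ℓ₁ u) (hℓ₂ : ∀ u, ℓ₂ (J u) = -(s * ℓ₂ u))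
    (h2 : (2 : F) ≠ 0) (P : V) (a b c d : F)
    (hx : ℓ₂ (a • P + b • J P) = 0) (hy : ℓ₁ (c • P + d • J P) = 0) :
    2 * (ℓ₁ P * ℓ₂ P) * B (a • P + b • J P) (c • P + d • J P)
      = B P P * (ℓ₁ (a • P + b • J P) * ℓ₂ (c • P + d • J P)) := by
  have := height_eq_polarised_logProduct B J ℓ₁ ℓ₂ s D hs hsymm hskew hBJ hℓ₁ hℓ₂ h2 P a b c d
  rw [hx, hy, mul_zero, add_zero] at this
  exact this

/-- **The regulator ratio is constant on the plane.**  `B(x,x) · ℓ₁(P) ℓ₂(P) = B(P,P) · ℓ₁(x) ℓ₂(x)`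
for every `x`: the quadratic forms `B(x,x)` and `ℓ₁ ℓ₂` are proportional (both transform by `D`
under `J`), so `ĥ(x) / (log_𝔭 x · log_𝔭̄ x)` does not depend on `x ∈ W(K₀) ⊗ F̄`. -/
theorem regulatorRatio_const (B : V →ₗ[F] V →ₗ[F] F) (J : V →ₗ[F] V)
    (ℓ₁ ℓ₂ : V →ₗ[F] F) (s D : F) (hs : s * s = -D)
    (hsymm : ∀ u v, B u v = B v u) (hskew : ∀ u v, B (J u) v = -B u (J v))
    (hBJ : ∀ u v, B (J u) (J v) = D * B u v)
    (hℓ₁ : ∀ u, ℓ₁ (J u) = s * ℓ₁ u) (hℓ₂ : ∀ u, ℓ₂ (J u) = -(s * ℓ₂ u))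
    (h2 : (2 : F) ≠ 0) (P : V) (a b : F) :
    (ℓ₁ P * ℓ₂ P) * B (a • P + b • J P) (a • P + b • J P)
      = B P P * (ℓ₁ (a • P + b • J P) * ℓ₂ (a • P + b • J P)) := by
  have h := height_eq_polarised_logProduct B J ℓ₁ ℓ₂ s D hs hsymm hskew hBJ hℓ₁ hℓ₂ h2 P a b a b
  have h' : (2 : F) * ((ℓ₁ P * ℓ₂ P) * B (a • P + b • J P) (a • P + b • J P))
      = 2 * (B P P * (ℓ₁ (a • P + b • J P) * ℓ₂ (a • P + b • J P))) := by
    linear_combination h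
  exact mul_left_cancel₀ h2 h'

/-- **Producer of purity (rank one ⇒ pure).**  A `J`-stable LINE is a `J`-eigenline, and the
eigenvalue is `± s`: if `J z = t • z`, `z ≠ 0`, `J (J z) = -D • z` then `t² = -D`.  (Dictionary: the
`(f₀, χ′)`-eigenline of `B(E^{ab}) ⊗ F̄` is one-dimensional for a NON-self-dual good pair — GZ–Kolyvagin
for the pair — and `J`-stable because the central CM of `B_{K₀}` is defined over `K₀` and the projector
`B_{K₀} → W` is `K₀`-linear; so the W-shadow `z⁺` of `P⁺_χ(f₊)` is type `ι` or type `ῑ`.) -/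
theorem eigenvalue_sq_of_stable_line (J : V →ₗ[F] V) (D t : F) (z : V) (hz0 : z ≠ 0)
    (hz : J z = t • z) (hJJ : J (J z) = -(D • z)) : t * t = -D := by
  have h1 : J (J z) = (t * t) • z := by rw [hz, map_smul, hz, smul_smul]
  have h2 : (t * t) • z = (-D) • z := by rw [← h1, hJJ, neg_smul]
  have h3 : (t * t - -D) • z = 0 := by rw [sub_smul, h2, sub_self]
  rcases smul_eq_zero.mp h3 with h | h
  · exact sub_eq_zero.mp h
  · exact absurd h hz0

/-- **Self-dual branch (balanced, not pure).**  If instead the pair is self-dual the eigenspace is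
the whole plane and the Heegner vector is fixed (up to sign) by complex conjugation `𝐜`
(`𝐜 P = P`, `𝐜 J = -J 𝐜`): then its two logarithms agree up to sign, `ℓ₂ z = ± ℓ₁ z`
(`ℓ₂ = ℓ₁ ∘ 𝐜`), so again no direction digit (`regulatorRatio_const` then reads
`B(z,z) ℓ₁(P)² = ± B(P,P) ℓ₁(z)²`). -/
theorem logs_agree_of_conj_fixed (cc : V →ₗ[F] V) (ℓ₁ ℓ₂ : V →ₗ[F] F)
    (hℓ₂ : ∀ u, ℓ₂ u = ℓ₁ (cc u)) (z : V) (ε : F) (hε : ε = 1 ∨ ε = -1)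
    (hz : cc z = ε • z) : ℓ₂ z = ε * ℓ₁ z := by
  rcases hε with h | h <;> subst h <;> simp [hℓ₂, hz]

end CMPlane

/-! ## §B  Square currency: the digit `β` is the projector gauge (ℤ-valued bookkeeping)

Digits (2-adic valuations at the fixed place `𝔓 ∣ 𝔭`): `vδ` = the height-transfer scalar of the
projector pair `(Φ, Φᶜ)`, `vlam` = the pullback scalar `Φ*ω_W = λ ω₊`, `vlogP` / `vlogM` = `ℓ₁(z⁺)` /
`ℓ₂(z⁻)`, `vζ` = the Gross–Castella–Hsieh conjugation constant (a root of unity times a sign).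
The square-currency ratio `(ℓ₁ z⁺)² / ⟨z⁺, z⁻⟩` then has digit `rsq = (vδ - 2 vlam) + (vlogP - vlogM)`
(by §A: `⟨z⁺,z⁻⟩ ∝ ℓ₁ z⁺ · ℓ₂ z⁻`). -/

section SquareCurrency

/-- A root of unity has valuation `0` (ℤ is torsion-free). -/
theorem val_rootOfUnity_zero (n vζ : ℤ) (hn : n ≠ 0) (h : n * vζ = 0) : vζ = 0 := by
  rcases mul_eq_zero.mp h with h | h
  · exact absurd h hn
  · exact h

/-- With the CONJUGATE partner `z⁻ = ζ · 𝐜 z⁺` one has `ℓ₂ z⁻ = ζ ℓ₁ z⁺` (transport: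
`ℓ₂ (𝐜 z) = ℓ₁ z`), hence `vlogM = vlogP + vζ = vlogP`, and the square-currency digit is the
canonical `vδ - 2 vlam` — NO direction term. -/
theorem squareDigit_conjPartner (vδ vlam vlogP vlogM vζ rsq : ℤ)
    (hr : rsq = (vδ - 2 * vlam) + (vlogP - vlogM)) (hM : vlogM = vlogP + vζ) (hζ : vζ = 0) :
    rsq = vδ - 2 * vlam := by omega

/-- Gauge invariance: replacing `Φ` by `[μ] ∘ Φ` shifts `vlam ↦ vlam + vμ`, `vδ ↦ vδ + 2 vμ`
(`B([μ]Φx, [μ̄]Φᶜy)`: on the type-`ῑ` line `[μ̄]²` acts by `ι(μ)²`), `vlogP ↦ vlogP + vμ`,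
`vlogM ↦ vlogM + vμ`; the digit is unchanged. -/
theorem squareDigit_gauge_invariant (vδ vlam vlogP vlogM vμ : ℤ) :
    ((vδ + 2 * vμ) - 2 * (vlam + vμ)) + ((vlogP + vμ) - (vlogM + vμ))
      = (vδ - 2 * vlam) + (vlogP - vlogM) := by ring

/-- The HERMITIAN partner (coefficient conjugate `z̄⁺ = κ̄ ū`) in a non-symmetric gauge: then
`vlogM = vlogP - (k - kbar)` up to the gauge term `g = v(λ/λᶜ)`, i.e. k3-g3's
`β = k - kbar` appears — and it EQUALS the gauge term: `β = g`.  (T3.2's second run averages the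
orbit `{Φ, Φᶜ}`; a `𝐜`-symmetric projector — Hilbert 90 — has `g = 0`.) -/
theorem beta_is_gauge (k kbar g β : ℤ) (hβ : β = k - kbar)
    (hGross : k - kbar = g) : β = g := by omega

/-- Consistency with T3.2 (k3-g6): the one-pair reading at `ι` has total digit `β + ε`, the reading
at `ῑ` has `-β + ε'` (conjugation swaps `k`, `kbar`), and both equal the CANONICAL total `t`
(a ratio of two canonical numbers does not know the embedding).  Hence `2β = ε' - ε` — exactly the
balance k3-g6 DERIVES — and the symmetrised sum `ε + ε' = 2t` is gauge-free: T3.2's second ERL run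
computes `t`, which §A delivers directly in product currency. -/
theorem t32_consistency (β ε ε' t : ℤ) (hι : β + ε = t) (hιbar : -β + ε' = t) :
    2 * β = ε' - ε ∧ ε + ε' = 2 * t := by omega

end SquareCurrency

/-! ## §C  P-R133 / B22♯ written out: the LZZ ÷ YZZ quotient is tensor-free

Symbols (all in a field; read «`v₂` of» afterwards): `LP` = `log_{A⁺}P⁺_χ(f₊)·log_{A⁻}P⁻_χ(f₋)`
(LZZ Thm 3.10 LHS), `HP` = `⟨P⁺_χ(f₊), P⁻_χ(f₋)⟩_{K,L}` (YZZ, CST (p.15) form), `calL` = `𝓛(A)(χ)`,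
`eps` = `L(1/2,ρ⊗χ̌_{𝔓ᶜ})²/ε(1/2,ψ,ρ⊗χ̌_{𝔓ᶜ})`, `pA` = LZZ's global pairing `(f₊,f₋)_A`,
`pU / vol` = YZZ's `Vol(X_U)⁻¹ (f₁,f₂)_U`, `beta` = `∏_v β_v(f_{+v},f_{-v})`, `cm` = Haar-measure
conversion, `Lder` = `L'(1/2,π_A,χ)`, `Lad` = `L(1,π_A,ad)`, `z2` = `ζ_F(2)`. -/

section TensorFree

variable {F : Type*} [Field F]

/-- The quotient `LP / HP` contains NO test-vector term: `∏ β_v` cancels; what remains is the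
p-adic value, the unit `eps`, the Petersson-normalisation ratio `pA·vol/pU` (tensor-independent: two
invariant pairings on `π⁺ × π⁻` are proportional — this is (a-norm)'s `a₀`), the measure constant,
and `Lad / (z2 · Lder)`. -/
theorem lzz_div_yzz_tensor_free (LP HP calL eps pA pU vol beta cm Lder Lad z2 : F)
    (hLP : LP = calL * eps * (pA * beta * cm))
    (hHP : HP = (pU / vol) * (Lder / (Lad / z2)) * beta)
    (hβ : beta ≠ 0) (hpU : pU ≠ 0) (hvol : vol ≠ 0) (hLder : Lder ≠ 0) (hLad : Lad ≠ 0)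
    (hz2 : z2 ≠ 0) :
    LP / HP = calL * eps * cm * (pA * vol / pU) * (Lad / (z2 * Lder)) := by
  rw [hLP, hHP]
  field_simp
  try ring

/-- Legitimacy at `v = 2`: both theorems hold for EVERY pure tensor, and LZZ's `α_χ` is a basis of a
one-dimensional space, hence a nonzero functional, hence nonzero on SOME tensor; any such tensor
(e.g. LZZ's `n`-admissible stable vectors at `𝔭`, explicit `α♮_𝔭 ≠ 0`) may be used on both sides. -/
theorem exists_tensor_of_functional_ne_zero {W : Type*} [AddCommGroup W] [Module F W]
    (α : W →ₗ[F] F) (hα : α ≠ 0) : ∃ f : W, α f ≠ 0 := by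
  by_contra h
  apply hα
  ext f
  rw [LinearMap.zero_apply]
  by_contra h'
  exact h ⟨f, h'⟩

end TensorFree

/-! ## §D  An `𝔽₁₁`-avatar of §A (`-7 ≡ 4 = 2²` in `𝔽₁₁`, so `s = 2`, `D = 7`)

Coordinates in the basis `(P, J P)`: `B = diag(h, 7h)`, `ℓ₁ = (L, 2L)`, `ℓ₂ = (L, -2L)`;
`z⁺ = y (2, 1)`, `z⁻ = y' (-2, 1)`.  Check `2 L² · B(z⁺,z⁻) = h · ℓ₁(z⁺) ℓ₂(z⁻)` for all
`h L y y' ∈ 𝔽₁₁` by `decide`. -/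

section Avatar

/-- pairing of `(x₁,x₂)` and `(y₁,y₂)` in the basis `(P, JP)` with `B = diag(h, 7h)`. -/
def Bav (h x₁ x₂ y₁ y₂ : ZMod 11) : ZMod 11 := h * (x₁ * y₁ + 7 * x₂ * y₂)
/-- `ℓ₁ = log` at `𝔭`: `(x₁, x₂) ↦ L (x₁ + 2 x₂)`. -/
def l1 (L x₁ x₂ : ZMod 11) : ZMod 11 := L * (x₁ + 2 * x₂)
/-- `ℓ₂ = log` at `𝔭̄`: `(x₁, x₂) ↦ L (x₁ - 2 x₂)`. -/
def l2 (L x₁ x₂ : ZMod 11) : ZMod 11 := L * (x₁ - 2 * x₂)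

theorem avatar_sq : (2 : ZMod 11) * 2 = -7 := by decide

/-- `2 · ℓ₁(P)ℓ₂(P) · B(z⁺,z⁻) = B(P,P) · ℓ₁(z⁺) ℓ₂(z⁻)` with `z⁺ = y(2,1)`, `z⁻ = y'(-2,1)`,
`P = (1,0)`, for ALL `h, L, y, y'`. -/
theorem avatar_transfer_two :
    ∀ h L y y' : ZMod 11,
      2 * (l1 L 1 0 * l2 L 1 0) * Bav h (y * 2) y (y' * -2) y'
        = Bav h 1 0 1 0 * (l1 L (y * 2) y * l2 L (y' * -2) y') := by decide

/-- and the eigenlines are isotropic / killed by the opposite logarithm. -/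
theorem avatar_isotropic_and_kernels :
    ∀ h L y : ZMod 11, Bav h (y * 2) y (y * 2) y = 0 ∧ l2 L (y * 2) y = 0 ∧ l1 L (y * -2) y = 0 := by
  decide

end Avatar

end Summit.BirchSwinnertonDyer.BirchSwinnertonDyer.Cruxes.SplitBadTwoLowerHalfOfFacts.HeegnerIndexTwo.K1G18
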